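import Summits.AnomalousDissipation.AnomalousDissipation.Theses.MirrorEnsemble
import Summits.AnomalousDissipation.AnomalousDissipation.Theses.PumpedMirror
import Summits.AnomalousDissipation.AnomalousDissipation.Theorems.TaylorGreenLoudGalerkinStates.Negative.Anatomy

/-!
# Routes MirrorEnsemble / PumpedMirror — support `TaylorGreenForceRegularTG` (stmt-AnomalousDissipation-15378)

The pinned Taylor–Green force
`f_TG = (sin 2πx₀ cos 2πx₁ cos 2πx₂, −cos 2πx₀ sin 2πx₁ cos 2πx₂, 0)`, written in the route files with the
Fourier characters (`(fourier 1 t).im = sin 2πt`, `(fourier 1 t).re = cos 2πt`), is an admissible force: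
smooth, divergence free and mean zero.

The lambda term of the item is, verbatim, the definition `Negative.tgForce` of
`Theorems/TaylorGreenLoudGalerkinStates/Negative/LoadBearing.lean`, and the three properties are the landed
corollaries `Negative.isSmooth_tgForce`, `Negative.isDivFree_tgForce`, `Negative.hasZeroMean_tgForce` of
`Negative.tgForce_eq_realTrigPoly` (`Theorems/TaylorGreenLoudGalerkinStates/Negative/Anatomy.lean`: `f_TG` is the
real trigonometric polynomial on the shell `{±1}³`, `|k|² = 3`, with transversal conjugate-symmetric coefficients
`f̂(k) = (i/8)(−k₀, k₁, 0)`, and `0 ∉` shell).  So the proof is: substitute the pinned force and quote them.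

The item is shared by the routes MirrorEnsemble and PumpedMirror (byte-identical statements); both route decls are
proved here from the one term-level statement `taylorGreenForce_regular`.  The route files themselves deliberately
do not import the MirrorVariety negative anatomy (rev-1 cone repair); only this proof file does.

Reference for the mathematics (folklore): M. E. Brachet, D. I. Meiron, S. A. Orszag, B. G. Nickel, R. H. Morf,
U. Frisch, *Small-scale structure of the Taylor–Green vortex*, J. Fluid Mech. 130 (1983) 411–452, §2
(doi:10.1017/s0022112083001159).
-/

-- `Summit.<Summit>.<Problem>` is the tree's mandated summit-side namespace (CONVENTIONS §2); for this
-- single-conjunct summit the two coincide, so the duplicate is deliberate.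
set_option linter.dupNamespace false

noncomputable section

open Literature.Analysis.FunctionSpaces Literature.Analysis.FunctionSpaces.Torus

namespace Summit.AnomalousDissipation.AnomalousDissipation.Theorems

open Summit.AnomalousDissipation.AnomalousDissipation.Theorems.TaylorGreenLoudGalerkinStates.Negative

/-- **The Taylor–Green force is an admissible force** (term-level form of the shared item
stmt-AnomalousDissipation-15378): every `f` equal to the pinned force
`x ↦ (Im e₁(x₀) Re e₁(x₁) Re e₁(x₂), −Re e₁(x₀) Im e₁(x₁) Re e₁(x₂), 0)` is smooth, divergence free and mean zero.
Proof: the pinned lambda is definitionally `Negative.tgForce`; substitute and quote `isSmooth_tgForce`,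
`isDivFree_tgForce`, `hasZeroMean_tgForce` (real trigonometric polynomial on the shell `|k|² = 3` with transversal
coefficients, `0 ∉` shell). [folklore] -/
theorem taylorGreenForce_regular :
    ∀ f : UnitAddTorus (Fin 3) → EuclideanSpace ℝ (Fin 3),
      f = (fun x => !₂[(fourier 1 (x 0) : ℂ).im * (fourier 1 (x 1) : ℂ).re * (fourier 1 (x 2) : ℂ).re,
        -((fourier 1 (x 0) : ℂ).re * (fourier 1 (x 1) : ℂ).im * (fourier 1 (x 2) : ℂ).re), (0 : ℝ)]) →
      IsSmooth f ∧ IsDivFree f ∧ HasZeroMean f := by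
  intro f hf
  subst hf
  exact ⟨isSmooth_tgForce, isDivFree_tgForce, hasZeroMean_tgForce⟩

/-- **Route decl `MirrorEnsemble.TaylorGreenForceRegularTG` (stmt-AnomalousDissipation-15378), proved**:
the pinned Taylor–Green force is smooth, divergence free and mean zero (`taylorGreenForce_regular`). [folklore] -/
theorem taylorGreenForceRegularTG_proof :
    Summit.AnomalousDissipation.AnomalousDissipation.Theses.MirrorEnsemble.TaylorGreenForceRegularTG := by
  unfold Summit.AnomalousDissipation.AnomalousDissipation.Theses.MirrorEnsemble.TaylorGreenForceRegularTG
  exact taylorGreenForce_regular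

/-- **Route decl `PumpedMirror.TaylorGreenForceRegularTG` (the same shared item stmt-AnomalousDissipation-15378,
as wanted by route PumpedMirror), proved**: the pinned Taylor–Green force is smooth, divergence free and mean
zero (`taylorGreenForce_regular`). [folklore] -/
theorem pumpedMirror_taylorGreenForceRegularTG_proof :
    Summit.AnomalousDissipation.AnomalousDissipation.Theses.PumpedMirror.TaylorGreenForceRegularTG := by
  unfold Summit.AnomalousDissipation.AnomalousDissipation.Theses.PumpedMirror.TaylorGreenForceRegularTG
  exact taylorGreenForce_regular

end Summit.AnomalousDissipation.AnomalousDissipation.Theorems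

end
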